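import Literature.NumberTheory.EllipticCurves.ZpExtensionEisensteinDVRSettingH4AnnSatMultiplicativeThreeProofs
import Literature.NumberTheory.EllipticCurves.ZpExtensionEisensteinDVRSettingH4AnnSatFlipMultiplicativeThreeProofs
import Literature.NumberTheory.EllipticCurves.ZpExtensionEisensteinDVRSettingH4RestrictedPairingMultiplicativeThreeProofs
import Literature.NumberTheory.EllipticCurves.ZpExtensionEisensteinDVRSettingH4RestrictedPairingFlipMultiplicativeThreeProofs
import Literature.NumberTheory.EllipticCurves.ZpExtensionEisensteinDVRSettingH4AnnSatOfLiftsProofs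
import HarnessLib

/-!
# (ANN-SAT) at a place `v ∣ 3` of MULTIPLICATIVE reduction for the canonical conjugation datum, restricted pairings discharged
# (theorems only — no definition, no named fact, no instance, no `sorry`)

Topic `NumberTheory/EllipticCurves` (LEAD `bsd-wall-utd-p1`, crux r205 stmt-BirchSwinnertonDyer-24737 `TwinAlgMuZeroAtThree`,
line `beta-road`, stub `stub_howardOutputsOfFamily`, E2 assembly at `v ∣ 3`).  Cell x9's
`ZpExtensionEisensteinDVRSettingH4AnnSatOfLiftsProofs` (both sides of (ANN-SAT) for `cd := ofLifts σ … τ …`, the restricted pairings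
supplied by `…RestrictedPairing{,Flip}Proofs`) assumes `IsOrdinaryAt W p` and good reduction with an ordinary point at `v`, `σ • v`.
For places of MULTIPLICATIVE reduction above `3` the four inputs exist (`…H4AnnSat{,Flip}MultiplicativeThreeProofs`,
`…H4RestrictedPairing{,Flip}MultiplicativeThreeProofs`); this file is x9's four statements and proofs at `p = 3` with
(`hordW`, `hgood`, `hord`, `hgoodσ`, `hordσ`) replaced by (`hmult`, `hmultσ`).  BSD is not proved by any of this.

References: [Howard2004HeegnerKolyvagin] §1.3 H.4, Lemma 3.1.1, Def. 3.2.6; [MilneADT2006] Ch. I Cor. 2.3; [GreenbergLNM1716] §2.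
-/

set_option autoImplicit false

noncomputable section

open Function NumberField IsDedekindDomain Field CategoryTheory
open scoped NumberField ContRepresentation

namespace WeierstrassCurve

open Literature.NumberTheory.EllipticCurves Literature.NumberTheory.GaloisRepresentations
open Literature.NumberTheory.GaloisRepresentations.DiscreteGaloisModule
open Literature.NumberTheory.GaloisCohomology Literature.NumberTheory.GaloisCohomology.Howard2004
open Literature.NumberTheory.EllipticCurves.IwasawaAlgebra Literature.NumberTheory.EllipticCurves.ZpExtension

variable {K : Type} [Field K] [NumberField K] (W : WeierstrassCurve ℚ) [W.IsElliptic]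
  (κ : ZpExtension K 3) {m : ℕ} (hm : 1 ≤ m)
  (σ : K ≃ₐ[ℚ] K) (hσ₁ : σ ≠ 1) (hσ : σ * σ = 1) (τ : AlgebraicClosure K ≃+* AlgebraicClosure K)
  (hτ : IsLiftOfAut σ τ) (hτ₂ : Function.Involutive τ)
  (D : letI := IwasawaAlgebra.isLocalRing_quotient_X_pow_add_C 3 hm
    ∀ k, DualityDatum 3 (ConjugationDatum.ofLifts σ hσ₁ hσ τ hτ hτ₂) ((W.eisensteinTower κ hm).ρ k) (EisensteinCoeff 3 m (k + 1)))

/-- **(ANN-SAT), `Y`-side, canonical conjugation datum, restricted pairings discharged.**  For `T := W.eisensteinTower κ hm`,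
`cd := ofLifts σ … τ …`, H.4 data `D k` with `he_red` whose pairings are the twisted Weil–τ forms (`hDe`), `W` ordinary at `p`,
a place `v ∋ p` with good reduction and an ordinary point at `v` and at `σ•v`, and `g₁ ∈ Γ_{K_v}` with `κ(τ⁻¹ g₁ τ) = p^s`,
`2p^s < m`: every compatible family of `(H¹(K_v, Tw T^{(j)}))_j` orthogonal to the saturated strict-ordinary families of
`(H¹(K_v, T^{(j)}))_j` at every level is saturated for the transported strict ordinary cores.
[cite: Howard2004HeegnerKolyvagin, §1.3 H.4, Lemma 3.1.1 and Def. 3.2.6 (arXiv p. 7 L78–82, p. 15–16)] [cite: MilneADT2006, Ch. I Cor. 2.3] -/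
theorem eisensteinTower_mem_saturatedFamilies_of_forall_localCup_eq_zero_ofLifts_of_hasMultiplicativeReductionAt_three
    (he_red : letI := IwasawaAlgebra.isLocalRing_quotient_X_pow_add_C 3 hm
      ∀ k (x y : EisensteinLevel 3 m (fun j ↦ geomTorsion (W.baseChange K) (((3 : ℕ) : ℤ) ^ j)) (k + 1 + 1)),
        IwasawaAlgebra.EisensteinCoeff.reduce 3 m (Nat.le_succ (k + 1)) ((D (k + 1)).e x y) =
          (D k).e ((W.eisensteinTower κ hm).red k x) ((W.eisensteinTower κ hm).red k y))
    {v : HeightOneSpectrum (𝓞 K)} [CharZero (v.adicCompletion K)]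
    (hmult : (W.baseChange K).HasMultiplicativeReductionAt v) (hpv : ((3 : ℕ) : 𝓞 K) ∈ v.asIdeal)
    (hmultσ : (W.baseChange K).HasMultiplicativeReductionAt (σ • v)) (hpσv : ((3 : ℕ) : 𝓞 K) ∈ (σ • v).asIdeal)
    (e : ∀ k, geomTorsion (W.baseChange K) (((3 : ℕ) : ℤ) ^ (k + 1)) →+ geomTorsion (W.baseChange K) (((3 : ℕ) : ℤ) ^ (k + 1)) →+
      MuCarrier K (3 ^ (k + 1)))
    (log : ∀ k, MuCarrier K (3 ^ (k + 1)) →+ ZMod (3 ^ (k + 1)))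
    (hDe : letI := IwasawaAlgebra.isLocalRing_quotient_X_pow_add_C 3 hm
      ∀ k, (D k).e = eisensteinDualityForm hm (k + 1) (conjPairing (e k) (hτ.torsionMap W (((3 : ℕ) : ℤ) ^ (k + 1))) (log k)))
    (halt : ∀ k a, e k a a = 0) (hnd : ∀ k b, (∀ a, e k a b = 0) → b = 0)
    (hθθ : ∀ (k : ℕ) (a : geomTorsion (W.baseChange K) (((3 : ℕ) : ℤ) ^ (k + 1))), hτ.torsionMap W _ (hτ.torsionMap W _ a) = a)
    (hlog : ∀ k, Bijective (log k))
    (hlogχ : ∀ (k : ℕ) (g : absoluteGaloisGroup K) ξ,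
      log k (mu K (3 ^ (k + 1)) g ξ) = cyclotomicCharacterModPow K 3 (k + 1) g * log k ξ)
    {g₁ : absoluteGaloisGroup (v.adicCompletion K)} {s : ℕ}
    (hg₁ : (κ ((ConjugationDatum.ofLifts σ hσ₁ hσ τ hτ hτ₂).conj (absGaloisRestrict K (v.adicCompletion K) g₁))).toAdd =
      ((3 ^ s : ℕ) : ℤ_[3]))
    (hms : 2 * 3 ^ s < m)
    {ζ : letI := IwasawaAlgebra.isLocalRing_quotient_X_pow_add_C 3 hm
      Π j, galoisCohomology (((ConjugationDatum.ofLifts σ hσ₁ hσ τ hτ hτ₂).twist ((W.eisensteinTower κ hm).ρ j)).toLocal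
        (Sum.inr v)) 1}
    (hζ : letI := IwasawaAlgebra.isLocalRing_quotient_X_pow_add_C 3 hm
      ζ ∈ Tower.compatibleFamilies
        (H := fun j ↦ galoisCohomology (((ConjugationDatum.ofLifts σ hσ₁ hσ τ hτ hτ₂).twist
          ((W.eisensteinTower κ hm).ρ j)).toLocal (Sum.inr v)) 1)
        (fun j ↦ ContinuousRep.cohomologyMap
          (((ConjugationDatum.ofLifts σ hσ₁ hσ τ hτ hτ₂).twist ((W.eisensteinTower κ hm).ρ (j + 1))).toLocal (Sum.inr v))
          (((ConjugationDatum.ofLifts σ hσ₁ hσ τ hτ hτ₂).twist ((W.eisensteinTower κ hm).ρ j)).toLocal (Sum.inr v))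
          ((W.eisensteinTower κ hm).red j).toAddMonoidHom
          continuous_of_discreteTopology (fun _ z => (W.eisensteinTower κ hm).red_equivariant j _ z) 1))
    (h0 : letI := IwasawaAlgebra.isLocalRing_quotient_X_pow_add_C 3 hm
      ∀ (j : ℕ), ∀ ξ ∈ Tower.saturatedFamilies
        (H := fun j ↦ galoisCohomology (((W.eisensteinTower κ hm).ρ j).toLocal (Sum.inr v)) 1)
        (fun j ↦ ContinuousRep.cohomologyMap (((W.eisensteinTower κ hm).ρ (j + 1)).toLocal (Sum.inr v))
          (((W.eisensteinTower κ hm).ρ j).toLocal (Sum.inr v)) ((W.eisensteinTower κ hm).red j).toAddMonoidHom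
          continuous_of_discreteTopology (fun _ z => (W.eisensteinTower κ hm).red_equivariant j _ z) 1) 3
        (fun j ↦ ((W.baseChange K).ordinaryFiltrationAt v (fun j ↦ (W.baseChange K).torsionGaloisModuleReduce 3 j)
          (fun _ _ ↦ rfl)).ordinaryCore hm (j + 1)),
        (D j).localCup (Sum.inr v) (ξ j) (ζ j) = 0) :
    letI := IwasawaAlgebra.isLocalRing_quotient_X_pow_add_C 3 hm
    ζ ∈ Tower.saturatedFamilies
      (H := fun j ↦ galoisCohomology (((ConjugationDatum.ofLifts σ hσ₁ hσ τ hτ hτ₂).twist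
        ((W.eisensteinTower κ hm).ρ j)).toLocal (Sum.inr v)) 1)
      (fun j ↦ ContinuousRep.cohomologyMap
        (((ConjugationDatum.ofLifts σ hσ₁ hσ τ hτ hτ₂).twist ((W.eisensteinTower κ hm).ρ (j + 1))).toLocal (Sum.inr v))
        (((ConjugationDatum.ofLifts σ hσ₁ hσ τ hτ hτ₂).twist ((W.eisensteinTower κ hm).ρ j)).toLocal (Sum.inr v))
        ((W.eisensteinTower κ hm).red j).toAddMonoidHom
        continuous_of_discreteTopology (fun _ z => (W.eisensteinTower κ hm).red_equivariant j _ z) 1) 3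
      (fun j ↦ (((W.baseChange K).ordinaryFiltrationAt ((ConjugationDatum.ofLifts σ hσ₁ hσ τ hτ hτ₂).σ • v)
          (fun j ↦ (W.baseChange K).torsionGaloisModuleReduce 3 j) (fun _ _ ↦ rfl)).ordinaryCore hm (j + 1)).map
        ((ConjugationDatum.ofLifts σ hσ₁ hσ τ hτ hτ₂).transportH1
          (κ.eisensteinTwist ((W.baseChange K).torsionGaloisModule (((3 : ℕ) : ℤ) ^ (j + 1))) hm (j + 1)) v)) := by
  letI := IwasawaAlgebra.isLocalRing_quotient_X_pow_add_C 3 hm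
  have hP := fun j ↦ W.eisensteinTower_restrictedPairing_nondegenerate_of_hasMultiplicativeReductionAt_three κ hm σ hσ₁ hσ
    τ hτ hτ₂ v hmult hpv j
    (fun j ↦ (W.baseChange K).torsionGaloisModuleReduce 3 j) (fun _ _ ↦ rfl) (D j) (e j) (log j) (hDe j) (halt j) (hnd j)
    (hθθ j) (hlog j) (hlogχ j) _ _ rfl rfl
    (((W.baseChange K).ordinaryFiltrationAt v (fun j ↦ (W.baseChange K).torsionGaloisModuleReduce 3 j)
      (fun _ _ ↦ rfl)).twistedFil_le_comap (κ := κ) hm (j + 1))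
    (ConjugationDatum.map_delta_le_comap_twist (ConjugationDatum.ofLifts σ hσ₁ hσ τ hτ hτ₂)
      ((W.eisensteinTower κ hm).ρ j) v _ fun g ↦
      ((W.baseChange K).ordinaryFiltrationAt (σ • v) (fun j ↦ (W.baseChange K).torsionGaloisModuleReduce 3 j)
        (fun _ _ ↦ rfl)).twistedFil_le_comap (κ := κ) hm (j + 1) g)
  choose P hPe hPnd _ using hP
  exact W.eisensteinTower_mem_saturatedFamilies_of_forall_localCup_eq_zero_of_hasMultiplicativeReductionAt_three κ hm
    (ConjugationDatum.ofLifts σ hσ₁ hσ τ hτ hτ₂) D he_red hmult hpv hmultσ hpσv P (fun j s t ↦ hPe j s t) (fun j y hy ↦ hPnd j y hy) hg₁ hms hζ h0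

/-- **(ANN-SAT), `X`-side, canonical conjugation datum, flipped restricted pairings discharged.**  Same hypotheses with
`g₀ ∈ Γ_{K_v}`, `κ(g₀) = p^s`: every compatible family of `(H¹(K_v, T^{(j)}))_j` orthogonal to the families of `(H¹(K_v, Tw T^{(j)}))_j`
saturated for the transported strict ordinary cores, at every level, is saturated for the strict ordinary cores at `v`.
[cite: Howard2004HeegnerKolyvagin, §1.3 H.4, Lemma 3.1.1 and Def. 3.2.6 (arXiv p. 7 L78–82, p. 15–16)] [cite: MilneADT2006, Ch. I Cor. 2.3] -/
theorem eisensteinTower_mem_saturatedFamilies_of_forall_localCup_flip_eq_zero_ofLifts_of_hasMultiplicativeReductionAt_three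
    (he_red : letI := IwasawaAlgebra.isLocalRing_quotient_X_pow_add_C 3 hm
      ∀ k (x y : EisensteinLevel 3 m (fun j ↦ geomTorsion (W.baseChange K) (((3 : ℕ) : ℤ) ^ j)) (k + 1 + 1)),
        IwasawaAlgebra.EisensteinCoeff.reduce 3 m (Nat.le_succ (k + 1)) ((D (k + 1)).e x y) =
          (D k).e ((W.eisensteinTower κ hm).red k x) ((W.eisensteinTower κ hm).red k y))
    {v : HeightOneSpectrum (𝓞 K)} [CharZero (v.adicCompletion K)]
    (hmult : (W.baseChange K).HasMultiplicativeReductionAt v) (hpv : ((3 : ℕ) : 𝓞 K) ∈ v.asIdeal)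
    (hmultσ : (W.baseChange K).HasMultiplicativeReductionAt (σ • v)) (hpσv : ((3 : ℕ) : 𝓞 K) ∈ (σ • v).asIdeal)
    (e : ∀ k, geomTorsion (W.baseChange K) (((3 : ℕ) : ℤ) ^ (k + 1)) →+ geomTorsion (W.baseChange K) (((3 : ℕ) : ℤ) ^ (k + 1)) →+
      MuCarrier K (3 ^ (k + 1)))
    (log : ∀ k, MuCarrier K (3 ^ (k + 1)) →+ ZMod (3 ^ (k + 1)))
    (hDe : letI := IwasawaAlgebra.isLocalRing_quotient_X_pow_add_C 3 hm
      ∀ k, (D k).e = eisensteinDualityForm hm (k + 1) (conjPairing (e k) (hτ.torsionMap W (((3 : ℕ) : ℤ) ^ (k + 1))) (log k)))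
    (halt : ∀ k a, e k a a = 0) (hnd : ∀ k b, (∀ a, e k a b = 0) → b = 0)
    (hθθ : ∀ (k : ℕ) (a : geomTorsion (W.baseChange K) (((3 : ℕ) : ℤ) ^ (k + 1))), hτ.torsionMap W _ (hτ.torsionMap W _ a) = a)
    (hlog : ∀ k, Bijective (log k))
    (hlogχ : ∀ (k : ℕ) (g : absoluteGaloisGroup K) ξ,
      log k (mu K (3 ^ (k + 1)) g ξ) = cyclotomicCharacterModPow K 3 (k + 1) g * log k ξ)
    {g₀ : absoluteGaloisGroup (v.adicCompletion K)} {s : ℕ}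
    (hg₀ : (κ (absGaloisRestrict K (v.adicCompletion K) g₀)).toAdd = ((3 ^ s : ℕ) : ℤ_[3]))
    (hms : 2 * 3 ^ s < m)
    {ξ : letI := IwasawaAlgebra.isLocalRing_quotient_X_pow_add_C 3 hm
      Π j, galoisCohomology (((W.eisensteinTower κ hm).ρ j).toLocal (Sum.inr v)) 1}
    (hξ : letI := IwasawaAlgebra.isLocalRing_quotient_X_pow_add_C 3 hm
      ξ ∈ Tower.compatibleFamilies
        (H := fun j ↦ galoisCohomology (((W.eisensteinTower κ hm).ρ j).toLocal (Sum.inr v)) 1)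
        (fun j ↦ ContinuousRep.cohomologyMap (((W.eisensteinTower κ hm).ρ (j + 1)).toLocal (Sum.inr v))
          (((W.eisensteinTower κ hm).ρ j).toLocal (Sum.inr v)) ((W.eisensteinTower κ hm).red j).toAddMonoidHom
          continuous_of_discreteTopology (fun _ z => (W.eisensteinTower κ hm).red_equivariant j _ z) 1))
    (h0 : letI := IwasawaAlgebra.isLocalRing_quotient_X_pow_add_C 3 hm
      ∀ (j : ℕ), ∀ η ∈ Tower.saturatedFamilies
        (H := fun j ↦ galoisCohomology (((ConjugationDatum.ofLifts σ hσ₁ hσ τ hτ hτ₂).twist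
          ((W.eisensteinTower κ hm).ρ j)).toLocal (Sum.inr v)) 1)
        (fun j ↦ ContinuousRep.cohomologyMap
          (((ConjugationDatum.ofLifts σ hσ₁ hσ τ hτ hτ₂).twist ((W.eisensteinTower κ hm).ρ (j + 1))).toLocal (Sum.inr v))
          (((ConjugationDatum.ofLifts σ hσ₁ hσ τ hτ hτ₂).twist ((W.eisensteinTower κ hm).ρ j)).toLocal (Sum.inr v))
          ((W.eisensteinTower κ hm).red j).toAddMonoidHom
          continuous_of_discreteTopology (fun _ z => (W.eisensteinTower κ hm).red_equivariant j _ z) 1) 3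
        (fun j ↦ (((W.baseChange K).ordinaryFiltrationAt ((ConjugationDatum.ofLifts σ hσ₁ hσ τ hτ hτ₂).σ • v)
            (fun j ↦ (W.baseChange K).torsionGaloisModuleReduce 3 j) (fun _ _ ↦ rfl)).ordinaryCore hm (j + 1)).map
          ((ConjugationDatum.ofLifts σ hσ₁ hσ τ hτ hτ₂).transportH1
            (κ.eisensteinTwist ((W.baseChange K).torsionGaloisModule (((3 : ℕ) : ℤ) ^ (j + 1))) hm (j + 1)) v)),
        (D j).localCup (Sum.inr v) (ξ j) (η j) = 0) :
    letI := IwasawaAlgebra.isLocalRing_quotient_X_pow_add_C 3 hm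
    ξ ∈ Tower.saturatedFamilies
      (H := fun j ↦ galoisCohomology (((W.eisensteinTower κ hm).ρ j).toLocal (Sum.inr v)) 1)
      (fun j ↦ ContinuousRep.cohomologyMap (((W.eisensteinTower κ hm).ρ (j + 1)).toLocal (Sum.inr v))
        (((W.eisensteinTower κ hm).ρ j).toLocal (Sum.inr v)) ((W.eisensteinTower κ hm).red j).toAddMonoidHom
        continuous_of_discreteTopology (fun _ z => (W.eisensteinTower κ hm).red_equivariant j _ z) 1) 3
      (fun j ↦ ((W.baseChange K).ordinaryFiltrationAt v (fun j ↦ (W.baseChange K).torsionGaloisModuleReduce 3 j)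
        (fun _ _ ↦ rfl)).ordinaryCore hm (j + 1)) := by
  letI := IwasawaAlgebra.isLocalRing_quotient_X_pow_add_C 3 hm
  have hP := fun j ↦ W.eisensteinTower_restrictedPairing_flip_nondegenerate_of_hasMultiplicativeReductionAt_three κ hm σ
    hσ₁ hσ τ hτ hτ₂ v hmult hpv j
    (fun j ↦ (W.baseChange K).torsionGaloisModuleReduce 3 j) (fun _ _ ↦ rfl) (D j) (e j) (log j) (hDe j) (halt j) (hnd j)
    (hθθ j) (hlog j) (hlogχ j) _ _ rfl rfl
    (((W.baseChange K).ordinaryFiltrationAt v (fun j ↦ (W.baseChange K).torsionGaloisModuleReduce 3 j)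
      (fun _ _ ↦ rfl)).twistedFil_le_comap (κ := κ) hm (j + 1))
    (ConjugationDatum.map_delta_le_comap_twist (ConjugationDatum.ofLifts σ hσ₁ hσ τ hτ hτ₂)
      ((W.eisensteinTower κ hm).ρ j) v _ fun g ↦
      ((W.baseChange K).ordinaryFiltrationAt (σ • v) (fun j ↦ (W.baseChange K).torsionGaloisModuleReduce 3 j)
        (fun _ _ ↦ rfl)).twistedFil_le_comap (κ := κ) hm (j + 1) g)
  choose P hPe _ hPnd using hP
  exact W.eisensteinTower_mem_saturatedFamilies_of_forall_localCup_flip_eq_zero_of_hasMultiplicativeReductionAt_three κ hm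
    (ConjugationDatum.ofLifts σ hσ₁ hσ τ hτ hτ₂) D he_red hmult hpv hmultσ hpσv P (fun j s t ↦ hPe j s t)
    (fun j x hx ↦ hPnd j x hx) hg₀ hms hξ h0


/-! ## §2 The non-degeneracy of the Weil–τ data discharged from the perfectness of `D` -/

/-- **(ANN-SAT), `Y`-side, canonical datum, restricted pairings AND the non-degeneracy of `e` discharged** (the
right non-degeneracy `hnd` of the Weil–τ datum `e k` follows from the perfectness of `D k` via `hDe`, `hθθ` —
x9-p1-w4 g7's `weilLog_nondegenerate_of_dualityDatum_e_eq`; the remaining binders are a subset of those of D1's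
`Stmt.exactAtP`).  For `T := W.eisensteinTower κ hm`,
`cd := ofLifts σ … τ …`, H.4 data `D k` with `he_red` whose pairings are the twisted Weil–τ forms (`hDe`), `W` ordinary at `p`,
a place `v ∋ p` with good reduction and an ordinary point at `v` and at `σ•v`, and `g₁ ∈ Γ_{K_v}` with `κ(τ⁻¹ g₁ τ) = p^s`,
`2p^s < m`: every compatible family of `(H¹(K_v, Tw T^{(j)}))_j` orthogonal to the saturated strict-ordinary families of
`(H¹(K_v, T^{(j)}))_j` at every level is saturated for the transported strict ordinary cores.
[cite: Howard2004HeegnerKolyvagin, §1.3 H.4, Lemma 3.1.1 and Def. 3.2.6 (arXiv p. 7 L78–82, p. 15–16)] [cite: MilneADT2006, Ch. I Cor. 2.3] -/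
theorem eisensteinTower_mem_saturatedFamilies_of_forall_localCup_eq_zero_ofLifts_of_hasMultiplicativeReductionAt_three'
    (he_red : letI := IwasawaAlgebra.isLocalRing_quotient_X_pow_add_C 3 hm
      ∀ k (x y : EisensteinLevel 3 m (fun j ↦ geomTorsion (W.baseChange K) (((3 : ℕ) : ℤ) ^ j)) (k + 1 + 1)),
        IwasawaAlgebra.EisensteinCoeff.reduce 3 m (Nat.le_succ (k + 1)) ((D (k + 1)).e x y) =
          (D k).e ((W.eisensteinTower κ hm).red k x) ((W.eisensteinTower κ hm).red k y))
    {v : HeightOneSpectrum (𝓞 K)} [CharZero (v.adicCompletion K)]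
    (hmult : (W.baseChange K).HasMultiplicativeReductionAt v) (hpv : ((3 : ℕ) : 𝓞 K) ∈ v.asIdeal)
    (hmultσ : (W.baseChange K).HasMultiplicativeReductionAt (σ • v)) (hpσv : ((3 : ℕ) : 𝓞 K) ∈ (σ • v).asIdeal)
    (e : ∀ k, geomTorsion (W.baseChange K) (((3 : ℕ) : ℤ) ^ (k + 1)) →+ geomTorsion (W.baseChange K) (((3 : ℕ) : ℤ) ^ (k + 1)) →+
      MuCarrier K (3 ^ (k + 1)))
    (log : ∀ k, MuCarrier K (3 ^ (k + 1)) →+ ZMod (3 ^ (k + 1)))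
    (hDe : letI := IwasawaAlgebra.isLocalRing_quotient_X_pow_add_C 3 hm
      ∀ k, (D k).e = eisensteinDualityForm hm (k + 1) (conjPairing (e k) (hτ.torsionMap W (((3 : ℕ) : ℤ) ^ (k + 1))) (log k)))
    (halt : ∀ k a, e k a a = 0)
    (hθθ : ∀ (k : ℕ) (a : geomTorsion (W.baseChange K) (((3 : ℕ) : ℤ) ^ (k + 1))), hτ.torsionMap W _ (hτ.torsionMap W _ a) = a)
    (hlog : ∀ k, Bijective (log k))
    (hlogχ : ∀ (k : ℕ) (g : absoluteGaloisGroup K) ξ,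
      log k (mu K (3 ^ (k + 1)) g ξ) = cyclotomicCharacterModPow K 3 (k + 1) g * log k ξ)
    {g₁ : absoluteGaloisGroup (v.adicCompletion K)} {s : ℕ}
    (hg₁ : (κ ((ConjugationDatum.ofLifts σ hσ₁ hσ τ hτ hτ₂).conj (absGaloisRestrict K (v.adicCompletion K) g₁))).toAdd =
      ((3 ^ s : ℕ) : ℤ_[3]))
    (hms : 2 * 3 ^ s < m)
    {ζ : letI := IwasawaAlgebra.isLocalRing_quotient_X_pow_add_C 3 hm
      Π j, galoisCohomology (((ConjugationDatum.ofLifts σ hσ₁ hσ τ hτ hτ₂).twist ((W.eisensteinTower κ hm).ρ j)).toLocal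
        (Sum.inr v)) 1}
    (hζ : letI := IwasawaAlgebra.isLocalRing_quotient_X_pow_add_C 3 hm
      ζ ∈ Tower.compatibleFamilies
        (H := fun j ↦ galoisCohomology (((ConjugationDatum.ofLifts σ hσ₁ hσ τ hτ hτ₂).twist
          ((W.eisensteinTower κ hm).ρ j)).toLocal (Sum.inr v)) 1)
        (fun j ↦ ContinuousRep.cohomologyMap
          (((ConjugationDatum.ofLifts σ hσ₁ hσ τ hτ hτ₂).twist ((W.eisensteinTower κ hm).ρ (j + 1))).toLocal (Sum.inr v))
          (((ConjugationDatum.ofLifts σ hσ₁ hσ τ hτ hτ₂).twist ((W.eisensteinTower κ hm).ρ j)).toLocal (Sum.inr v))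
          ((W.eisensteinTower κ hm).red j).toAddMonoidHom
          continuous_of_discreteTopology (fun _ z => (W.eisensteinTower κ hm).red_equivariant j _ z) 1))
    (h0 : letI := IwasawaAlgebra.isLocalRing_quotient_X_pow_add_C 3 hm
      ∀ (j : ℕ), ∀ ξ ∈ Tower.saturatedFamilies
        (H := fun j ↦ galoisCohomology (((W.eisensteinTower κ hm).ρ j).toLocal (Sum.inr v)) 1)
        (fun j ↦ ContinuousRep.cohomologyMap (((W.eisensteinTower κ hm).ρ (j + 1)).toLocal (Sum.inr v))
          (((W.eisensteinTower κ hm).ρ j).toLocal (Sum.inr v)) ((W.eisensteinTower κ hm).red j).toAddMonoidHom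
          continuous_of_discreteTopology (fun _ z => (W.eisensteinTower κ hm).red_equivariant j _ z) 1) 3
        (fun j ↦ ((W.baseChange K).ordinaryFiltrationAt v (fun j ↦ (W.baseChange K).torsionGaloisModuleReduce 3 j)
          (fun _ _ ↦ rfl)).ordinaryCore hm (j + 1)),
        (D j).localCup (Sum.inr v) (ξ j) (ζ j) = 0) :
    letI := IwasawaAlgebra.isLocalRing_quotient_X_pow_add_C 3 hm
    ζ ∈ Tower.saturatedFamilies
      (H := fun j ↦ galoisCohomology (((ConjugationDatum.ofLifts σ hσ₁ hσ τ hτ hτ₂).twist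
        ((W.eisensteinTower κ hm).ρ j)).toLocal (Sum.inr v)) 1)
      (fun j ↦ ContinuousRep.cohomologyMap
        (((ConjugationDatum.ofLifts σ hσ₁ hσ τ hτ hτ₂).twist ((W.eisensteinTower κ hm).ρ (j + 1))).toLocal (Sum.inr v))
        (((ConjugationDatum.ofLifts σ hσ₁ hσ τ hτ hτ₂).twist ((W.eisensteinTower κ hm).ρ j)).toLocal (Sum.inr v))
        ((W.eisensteinTower κ hm).red j).toAddMonoidHom
        continuous_of_discreteTopology (fun _ z => (W.eisensteinTower κ hm).red_equivariant j _ z) 1) 3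
      (fun j ↦ (((W.baseChange K).ordinaryFiltrationAt ((ConjugationDatum.ofLifts σ hσ₁ hσ τ hτ hτ₂).σ • v)
          (fun j ↦ (W.baseChange K).torsionGaloisModuleReduce 3 j) (fun _ _ ↦ rfl)).ordinaryCore hm (j + 1)).map
        ((ConjugationDatum.ofLifts σ hσ₁ hσ τ hτ hτ₂).transportH1
          (κ.eisensteinTwist ((W.baseChange K).torsionGaloisModule (((3 : ℕ) : ℤ) ^ (j + 1))) hm (j + 1)) v)) :=
  W.eisensteinTower_mem_saturatedFamilies_of_forall_localCup_eq_zero_ofLifts_of_hasMultiplicativeReductionAt_three κ hm σ hσ₁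
    hσ τ hτ hτ₂ D he_red hmult hpv hmultσ hpσv e log hDe halt
    (fun k ↦ (W.weilLog_nondegenerate_of_dualityDatum_e_eq κ hm (ConjugationDatum.ofLifts σ hσ₁ hσ τ hτ hτ₂) k (D k) (e k)
      (log k) (hDe k) (hθθ k)).2.2.2.2.2.2)
    hθθ hlog hlogχ hg₁ hms hζ h0

/-- **(ANN-SAT), `X`-side, canonical datum, flipped restricted pairings AND the non-degeneracy of `e` discharged.**  Same hypotheses with
`g₀ ∈ Γ_{K_v}`, `κ(g₀) = p^s`: every compatible family of `(H¹(K_v, T^{(j)}))_j` orthogonal to the families of `(H¹(K_v, Tw T^{(j)}))_j`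
saturated for the transported strict ordinary cores, at every level, is saturated for the strict ordinary cores at `v`.
[cite: Howard2004HeegnerKolyvagin, §1.3 H.4, Lemma 3.1.1 and Def. 3.2.6 (arXiv p. 7 L78–82, p. 15–16)] [cite: MilneADT2006, Ch. I Cor. 2.3] -/
theorem eisensteinTower_mem_saturatedFamilies_of_forall_localCup_flip_eq_zero_ofLifts_of_hasMultiplicativeReductionAt_three'
    (he_red : letI := IwasawaAlgebra.isLocalRing_quotient_X_pow_add_C 3 hm
      ∀ k (x y : EisensteinLevel 3 m (fun j ↦ geomTorsion (W.baseChange K) (((3 : ℕ) : ℤ) ^ j)) (k + 1 + 1)),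
        IwasawaAlgebra.EisensteinCoeff.reduce 3 m (Nat.le_succ (k + 1)) ((D (k + 1)).e x y) =
          (D k).e ((W.eisensteinTower κ hm).red k x) ((W.eisensteinTower κ hm).red k y))
    {v : HeightOneSpectrum (𝓞 K)} [CharZero (v.adicCompletion K)]
    (hmult : (W.baseChange K).HasMultiplicativeReductionAt v) (hpv : ((3 : ℕ) : 𝓞 K) ∈ v.asIdeal)
    (hmultσ : (W.baseChange K).HasMultiplicativeReductionAt (σ • v)) (hpσv : ((3 : ℕ) : 𝓞 K) ∈ (σ • v).asIdeal)
    (e : ∀ k, geomTorsion (W.baseChange K) (((3 : ℕ) : ℤ) ^ (k + 1)) →+ geomTorsion (W.baseChange K) (((3 : ℕ) : ℤ) ^ (k + 1)) →+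
      MuCarrier K (3 ^ (k + 1)))
    (log : ∀ k, MuCarrier K (3 ^ (k + 1)) →+ ZMod (3 ^ (k + 1)))
    (hDe : letI := IwasawaAlgebra.isLocalRing_quotient_X_pow_add_C 3 hm
      ∀ k, (D k).e = eisensteinDualityForm hm (k + 1) (conjPairing (e k) (hτ.torsionMap W (((3 : ℕ) : ℤ) ^ (k + 1))) (log k)))
    (halt : ∀ k a, e k a a = 0)
    (hθθ : ∀ (k : ℕ) (a : geomTorsion (W.baseChange K) (((3 : ℕ) : ℤ) ^ (k + 1))), hτ.torsionMap W _ (hτ.torsionMap W _ a) = a)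
    (hlog : ∀ k, Bijective (log k))
    (hlogχ : ∀ (k : ℕ) (g : absoluteGaloisGroup K) ξ,
      log k (mu K (3 ^ (k + 1)) g ξ) = cyclotomicCharacterModPow K 3 (k + 1) g * log k ξ)
    {g₀ : absoluteGaloisGroup (v.adicCompletion K)} {s : ℕ}
    (hg₀ : (κ (absGaloisRestrict K (v.adicCompletion K) g₀)).toAdd = ((3 ^ s : ℕ) : ℤ_[3]))
    (hms : 2 * 3 ^ s < m)
    {ξ : letI := IwasawaAlgebra.isLocalRing_quotient_X_pow_add_C 3 hm
      Π j, galoisCohomology (((W.eisensteinTower κ hm).ρ j).toLocal (Sum.inr v)) 1}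
    (hξ : letI := IwasawaAlgebra.isLocalRing_quotient_X_pow_add_C 3 hm
      ξ ∈ Tower.compatibleFamilies
        (H := fun j ↦ galoisCohomology (((W.eisensteinTower κ hm).ρ j).toLocal (Sum.inr v)) 1)
        (fun j ↦ ContinuousRep.cohomologyMap (((W.eisensteinTower κ hm).ρ (j + 1)).toLocal (Sum.inr v))
          (((W.eisensteinTower κ hm).ρ j).toLocal (Sum.inr v)) ((W.eisensteinTower κ hm).red j).toAddMonoidHom
          continuous_of_discreteTopology (fun _ z => (W.eisensteinTower κ hm).red_equivariant j _ z) 1))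
    (h0 : letI := IwasawaAlgebra.isLocalRing_quotient_X_pow_add_C 3 hm
      ∀ (j : ℕ), ∀ η ∈ Tower.saturatedFamilies
        (H := fun j ↦ galoisCohomology (((ConjugationDatum.ofLifts σ hσ₁ hσ τ hτ hτ₂).twist
          ((W.eisensteinTower κ hm).ρ j)).toLocal (Sum.inr v)) 1)
        (fun j ↦ ContinuousRep.cohomologyMap
          (((ConjugationDatum.ofLifts σ hσ₁ hσ τ hτ hτ₂).twist ((W.eisensteinTower κ hm).ρ (j + 1))).toLocal (Sum.inr v))
          (((ConjugationDatum.ofLifts σ hσ₁ hσ τ hτ hτ₂).twist ((W.eisensteinTower κ hm).ρ j)).toLocal (Sum.inr v))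
          ((W.eisensteinTower κ hm).red j).toAddMonoidHom
          continuous_of_discreteTopology (fun _ z => (W.eisensteinTower κ hm).red_equivariant j _ z) 1) 3
        (fun j ↦ (((W.baseChange K).ordinaryFiltrationAt ((ConjugationDatum.ofLifts σ hσ₁ hσ τ hτ hτ₂).σ • v)
            (fun j ↦ (W.baseChange K).torsionGaloisModuleReduce 3 j) (fun _ _ ↦ rfl)).ordinaryCore hm (j + 1)).map
          ((ConjugationDatum.ofLifts σ hσ₁ hσ τ hτ hτ₂).transportH1
            (κ.eisensteinTwist ((W.baseChange K).torsionGaloisModule (((3 : ℕ) : ℤ) ^ (j + 1))) hm (j + 1)) v)),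
        (D j).localCup (Sum.inr v) (ξ j) (η j) = 0) :
    letI := IwasawaAlgebra.isLocalRing_quotient_X_pow_add_C 3 hm
    ξ ∈ Tower.saturatedFamilies
      (H := fun j ↦ galoisCohomology (((W.eisensteinTower κ hm).ρ j).toLocal (Sum.inr v)) 1)
      (fun j ↦ ContinuousRep.cohomologyMap (((W.eisensteinTower κ hm).ρ (j + 1)).toLocal (Sum.inr v))
        (((W.eisensteinTower κ hm).ρ j).toLocal (Sum.inr v)) ((W.eisensteinTower κ hm).red j).toAddMonoidHom
        continuous_of_discreteTopology (fun _ z => (W.eisensteinTower κ hm).red_equivariant j _ z) 1) 3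
      (fun j ↦ ((W.baseChange K).ordinaryFiltrationAt v (fun j ↦ (W.baseChange K).torsionGaloisModuleReduce 3 j)
        (fun _ _ ↦ rfl)).ordinaryCore hm (j + 1)) :=
  W.eisensteinTower_mem_saturatedFamilies_of_forall_localCup_flip_eq_zero_ofLifts_of_hasMultiplicativeReductionAt_three κ hm
    σ hσ₁ hσ τ hτ hτ₂ D he_red hmult hpv hmultσ hpσv e log hDe halt
    (fun k ↦ (W.weilLog_nondegenerate_of_dualityDatum_e_eq κ hm (ConjugationDatum.ofLifts σ hσ₁ hσ τ hτ hτ₂) k (D k) (e k)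
      (log k) (hDe k) (hθθ k)).2.2.2.2.2.2)
    hθθ hlog hlogχ hg₀ hms hξ h0

end WeierstrassCurve

end
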